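import Summits.BirchSwinnertonDyer.BirchSwinnertonDyer.Theorems.ManinLocalTwoThreeShimuraIndexAtMultiplicativeThree
import Summits.BirchSwinnertonDyer.BirchSwinnertonDyer.Theorems.ManinLocalTwoThreeShimuraIndexMuThreeLine
import Summits.BirchSwinnertonDyer.BirchSwinnertonDyer.Theorems.ManinLocalTwoThreeShimuraRationalThreeIsogeny
import Literature.NumberTheory.EllipticCurves.WeilPairingProofs
import Literature.NumberTheory.EllipticCurves.DivisionPolynomialTorsion
import Literature.NumberTheory.EllipticCurves.ThreeDivisionFieldSwanProofs
import HarnessLib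

/-!
# E-an-226 `MuThreeSignAtThree` is a THEOREM: `3 ∥ N` and `μ₃ ⊂ W` force `λ₃(f) = −1` — the `μ₃`-point of `W[3]` and, by the WEIL PAIRING,
# a `Γ_ℚ`-fixed non-zero `3`-torsion point for every `σ` (cell `bsd-f2-manin`; an g40 FILE M `ManinAdditive/HesseOptimalityAtThree.lean`;
# bears on crux C3 `ManinPrimeToThreeAtNine`, stmt-BirchSwinnertonDyer-22968, through an's `3 ∥ N` nodes; prover p2 gen 19)

Summit `BirchSwinnertonDyer`, route `ManinLocalTwoThree`; deciding theorem of the line = C3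
`Summit.BirchSwinnertonDyer.BirchSwinnertonDyer.Theses.ManinLocalTwoThree.ManinPrimeToThreeAtNine` (NOT proved here; `9 ∣ N` is untouched).
Sequel to `Theorems/ManinLocalTwoThreeShimuraIndexAtMultiplicativeThree.lean` (p744182: the engine
`hasSplitMultiplicativeReductionAtPrime_three_of_forall_exists_smul_eq`, E-an-226♮ and the node
`ShimuraIndexPrimeToThreeAtMultiplicativeThree`).  Here the `μ₃` twin, so that BOTH inputs of an's conditional edge
`HesseOptimality.shimuraIndexPrimeToThreeAtMultiplicativeThree_of_signLemmas` are tree theorems: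

* §1 `hasShortMuThree_one_of_hasShortMuThree` — `HasShortMuThree W c → HasShortMuThree W 1` (`(X₀, T₀) ↦ (X₀/c², T₀/c³)`).
* §2 `exists_geomTorsion_of_hasShortMuThree` — the `μ₃`-POINT: from `Ψ₃(X₁) = 0`, `X₁³ + AX₁ + B = −3T₁²` on `E_{W,1}`, the point
  `P = (X₁ − b₂/12, θT₁ − (a₁x + a₃)/2)` of `W(ℚ̄)`, `θ² = −3`, has order `3` (`Ψ₃`, tree `three_smul_some_eq_zero_iff`,
  `Ψ₃_eval_sub_b₂_div_twelve`), and `σP = P` if `σθ = θ`, `σP = −P` if `σθ = −θ` (its abscissa is rational, `2y + a₁x + a₃ = 2θT₁`).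
* §3 `forall_exists_smul_eq_of_hasShortMuThree` — **every `σ ∈ Γ_ℚ` fixes a non-zero point of `W[3]`**: if `σθ = −θ`, take `Q` with
  `ζ := e₃(Q, P) ≠ 1` (Weil pairing, tree `exists_weilPairing_holds`: bilinear, alternating, non-degenerate, equivariant); `(2ζ + 1)² = −3`
  forces `σζ = ζ²`, and `σζ = e₃(σQ, σP) = e₃(σQ, −P) = e₃(σQ, P)⁻¹` gives `e₃(σQ, P) = ζ`, so `S := σQ − Q` is in the kernel of `e₃(·, P)`,
  which is the line `{O, ±P}` (a subgroup of order `3` of the `𝔽₃`-plane `W[3]`: Lagrange `natCard_geomTorsion` + non-degeneracy); `σ`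
  acts by `−1` on that line, hence `σ(Q − S) = Q + S + S = Q − S ≠ O` (as `Q ∉ ker`).  This is «`det ρ̄₃ = ω` on the `μ₃`-line» made explicit.
* §4 **`muThreeSignAtThree_holds : MuThreeSignAtThree`** (E-an-226 BY NAME, unconditional): `3 ∥ N` ⟹ multiplicative at `3`
  (`hasMultiplicativeReductionAtPrime_three_of_three_exactly_dvd_level`), §3 + the engine ⟹ SPLIT ⟹ `a₃ = +1`, `λ₃ = −1`;
  an's own composition `…_of_signLemmas muThreeSignAtThree_holds threeTorsionSignAtThree_holds` now runs with both sign lemmas discharged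
  (a second proof of p744182's node theorem; not restated here).

HONEST FRAMING.  Unconditional tree theorems (standard axioms); no definition, no named fact, no `sorry`.  Nothing here touches `9 ∣ N`:
C3, E-an-221, Manin's conjecture and BSD are NOT proved by this file.
References: [SilvermanAEC2009] III.1, Prop. III.8.1 (Weil pairing), Exercise 3.7, Thm. VII.6.1; [SilvermanCSS1997] Ch. II §§7–8 (`det ρ̄ = χ`);
[Katz1980] Thm. 2; [AtkinLehner1970] Thm. 3.
-/

set_option linter.dupNamespace false
set_option autoImplicit false

noncomputable section

open scoped Classical MatrixGroups ModularForm

open CongruenceSubgroup WeierstrassCurve Field Polynomial IsDedekindDomain NumberField Rat.HeightOneSpectrum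
  Literature.NumberTheory.EllipticCurves
  Literature.NumberTheory.EllipticCurves.ModularForms
  Summit.BirchSwinnertonDyer.Rank1Residual
  Summit.BirchSwinnertonDyer.Rank1Residual.ManinAdditive
  Summit.BirchSwinnertonDyer.Rank1Residual.ManinAdditive.KatoCurve
  Summit.BirchSwinnertonDyer.Rank1Residual.ManinAdditive.HesseOptimality
  Summit.BirchSwinnertonDyer.Rank1Residual.ManinAdditive.CuspidalKummer
  Summit.BirchSwinnertonDyer.Rank1Residual.ManinAdditive.CuspidalKummerThree

namespace Summit.BirchSwinnertonDyer.BirchSwinnertonDyer.Theorems.ManinLocalTwoThree.ShimuraIndexAtThree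

/-- Two affine points with equal coordinates are equal (proof-irrelevance plumbing). [folklore] -/
private theorem point_some_eq_some {F : Type*} [Field F] {V : WeierstrassCurve F} {x y x' y' : F}
    (h : V.toAffine.Nonsingular x y) (h' : V.toAffine.Nonsingular x' y') (hx : x = x') (hy : y = y') :
    (Affine.Point.some x y h : V.toAffine.Point) = Affine.Point.some x' y' h' := by
  subst hx hy; rfl

/-! ## §1 Rescaling `HasShortMuThree W c → HasShortMuThree W 1` -/

/-- The `μ₃`-configuration on `E_{W,c}` rescales to `E_{W,1}`: `(X₀, T₀) ↦ (X₀/c², T₀/c³)`. [cite: SilvermanAEC2009, III.1 and Exercise 3.7] -/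
theorem hasShortMuThree_one_of_hasShortMuThree (W : WeierstrassCurve ℚ) {c : ℤ} (hc : c ≠ 0)
    (h : HasShortMuThree W c) : HasShortMuThree W 1 := by
  obtain ⟨X₀, T₀, hΨ, hT₀, hcub⟩ := h
  have hcQ : (c : ℚ) ≠ 0 := Int.cast_ne_zero.mpr hc
  rw [isRoot_Ψ₃_shortModel_iff] at hΨ
  have ha4 : (shortModel W c).a₄ = (c : ℚ) ^ 4 * (shortModel W 1).a₄ := by simp [shortModel]; ring
  have ha6 : (shortModel W c).a₆ = (c : ℚ) ^ 6 * (shortModel W 1).a₆ := by simp [shortModel]; ring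
  rw [ha4, ha6] at hΨ hcub
  refine ⟨X₀ / (c : ℚ) ^ 2, T₀ / (c : ℚ) ^ 3, ?_, div_ne_zero hT₀ (pow_ne_zero 3 hcQ), ?_⟩
  · rw [isRoot_Ψ₃_shortModel_iff]
    field_simp
    linear_combination hΨ
  · field_simp
    linear_combination hcub

/-! ## §2 The geometric `μ₃`-point: a point `P ∈ W[3]` with `x(P) ∈ ℚ`, `σP = ±P` according to `σ(√−3) = ±√−3` -/

/-- **The `μ₃`-point of `W[3]`.**  From `HasShortMuThree W 1` (`Ψ₃(X₁) = 0`, `X₁³ + AX₁ + B = −3T₁²` on the short model): the point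
`P = (X₁ − b₂/12, θT₁ − (a₁x + a₃)/2)` of `W` over `ℚ̄`, `θ² = −3`, has order `3`, and every `σ ∈ Γ_ℚ` moves it to `P` if
`σθ = θ` and to `−P` if `σθ = −θ`. [cite: SilvermanAEC2009, III.1 and Exercise 3.7] -/
theorem exists_geomTorsion_of_hasShortMuThree (W : WeierstrassCurve ℚ) [W.IsElliptic] (h : HasShortMuThree W 1) :
    ∃ (θ : AlgebraicClosure ℚ) (P : W.geomTorsion 3), θ ^ 2 = -3 ∧ P ≠ 0 ∧
      ∀ σ : absoluteGaloisGroup ℚ,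
        ((show AlgebraicClosure ℚ ≃ₐ[ℚ] AlgebraicClosure ℚ from σ) θ = θ → σ • P = P) ∧
        ((show AlgebraicClosure ℚ ≃ₐ[ℚ] AlgebraicClosure ℚ from σ) θ = -θ → σ • P = -P) := by
  obtain ⟨X₁, T₁, hΨ, hT₁, hcub⟩ := h
  set Kb := AlgebraicClosure ℚ with hKb
  set ι := algebraMap ℚ Kb with hι
  -- `θ = √−3`
  obtain ⟨θ, hθ⟩ := IsAlgClosed.exists_eq_mul_self (-3 : Kb)
  have hθsq : θ ^ 2 = -3 := by rw [sq]; exact hθ.symm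
  have hθ0 : θ ≠ 0 := fun h0 ↦ by rw [h0] at hθsq; norm_num at hθsq
  -- the rational abscissa and the key identity `4x₀³ + b₂x₀² + 2b₄x₀ + b₆ = −12T₁²`
  set x₀ : ℚ := X₁ - W.b₂ / 12 with hx₀
  have ex : x₀ + W.b₂ / 12 = X₁ := by rw [hx₀]; ring
  have hS : 4 * x₀ ^ 3 + W.b₂ * x₀ ^ 2 + 2 * W.b₄ * x₀ + W.b₆ = -12 * T₁ ^ 2 := by
    have h := shortModel_cubic_eq W 1 x₀
    simp only [Int.cast_one, one_pow, one_mul, ex] at h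
    linear_combination 4 * h.symm.trans hcub
  -- the point over `ℚ̄`
  set x : Kb := ι x₀ with hx
  set y : Kb := θ * ι T₁ - (ι W.a₁ * ι x₀ + ι W.a₃) / 2 with hy
  have ha₁ : (W.baseChange Kb).a₁ = ι W.a₁ := rfl
  have ha₂ : (W.baseChange Kb).a₂ = ι W.a₂ := rfl
  have ha₃ : (W.baseChange Kb).a₃ = ι W.a₃ := rfl
  have ha₄ : (W.baseChange Kb).a₄ = ι W.a₄ := rfl
  have ha₆ : (W.baseChange Kb).a₆ = ι W.a₆ := rfl
  have hSK : 4 * x ^ 3 + ι W.b₂ * x ^ 2 + 2 * ι W.b₄ * x + ι W.b₆ = -12 * (ι T₁) ^ 2 := by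
    have h := congrArg ι hS
    simp only [map_add, map_mul, map_pow, map_neg, map_ofNat] at h
    rw [hx]; exact h
  have heq : (W.baseChange Kb).toAffine.Equation x y := by
    rw [WeierstrassCurve.Affine.equation_iff, ha₁, ha₂, ha₃, ha₄, ha₆]
    have hb : 4 * x ^ 3 + ι W.b₂ * x ^ 2 + 2 * ι W.b₄ * x + ι W.b₆ =
        4 * (x ^ 3 + ι W.a₂ * x ^ 2 + ι W.a₄ * x + ι W.a₆) + (ι W.a₁ * x + ι W.a₃) ^ 2 := by
      simp only [WeierstrassCurve.b₂, WeierstrassCurve.b₄, WeierstrassCurve.b₆, map_add, map_mul, map_pow, map_ofNat]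
      ring
    rw [hb] at hSK
    have hθT : (θ * ι T₁) ^ 2 = -3 * (ι T₁) ^ 2 := by rw [mul_pow, hθsq]
    rw [hy, hx]
    rw [hx] at hSK
    linear_combination (-1 / 4 : Kb) * hSK + hθT
  have hns : (W.baseChange Kb).toAffine.Nonsingular x y := (WeierstrassCurve.Affine.equation_iff_nonsingular).mp heq
  have hnegY : (W.baseChange Kb).toAffine.negY x y = -y - ι W.a₁ * x - ι W.a₃ := rfl
  have hw : 2 * y + ι W.a₁ * x + ι W.a₃ = 2 * θ * ι T₁ := by rw [hy, hx]; ring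
  have hT₁K : ι T₁ ≠ 0 := (map_ne_zero ι).mpr hT₁
  have hyneg : y ≠ (W.baseChange Kb).toAffine.negY x y := by
    intro h
    rw [hnegY] at h
    have h2 : 2 * y + ι W.a₁ * x + ι W.a₃ = 0 := by linear_combination h
    rw [hw] at h2
    exact mul_ne_zero (mul_ne_zero two_ne_zero hθ0) hT₁K h2
  -- order `3`: `Ψ₃(x₀) = 0`
  have hsm : shortModel W 1 = (⟨0, 0, 0, -W.c₄ / 48, -W.c₆ / 864⟩ : WeierstrassCurve ℚ) := by
    ext <;> simp [shortModel] <;> ring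
  have hq : W.Ψ₃.eval x₀ = 0 := by
    rw [hx₀, Ψ₃_eval_sub_b₂_div_twelve, ← hsm]
    exact hΨ.eq_zero
  have h3 : (3 : ℤ) • (Affine.Point.some _ _ hns : (W.baseChange Kb).toAffine.Point) = 0 := by
    rw [WeierstrassCurve.three_smul_some_eq_zero_iff hns hyneg, WeierstrassCurve.ψ_three, Polynomial.evalEval_C]
    have hmap : (W.baseChange Kb).Ψ₃ = W.Ψ₃.map ι := WeierstrassCurve.map_Ψ₃ W ι
    rw [hmap, Polynomial.eval_map, hx, Polynomial.eval₂_hom, hq, map_zero]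
  set P₀ : W.geomPoints := Affine.Point.some _ _ hns with hP₀def
  have hmem : P₀ ∈ W.geomTorsion 3 := (Submodule.mem_torsionBy_iff (3 : ℤ) P₀).mpr h3
  have hP0 : (⟨P₀, hmem⟩ : W.geomTorsion 3) ≠ 0 := by
    intro h0
    have : P₀ = 0 := congrArg Subtype.val h0
    rw [hP₀def] at this
    exact WeierstrassCurve.Affine.Point.some_ne_zero hns this
  refine ⟨θ, ⟨P₀, hmem⟩, hθsq, hP0, fun σ ↦ ⟨fun hσ ↦ ?_, fun hσ ↦ ?_⟩⟩
  · -- `σθ = θ`: `σ` fixes both coordinates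
    apply Subtype.ext
    set τ : Kb ≃ₐ[ℚ] Kb := σ with hτ
    change Affine.Point.map (τ : Kb →ₐ[ℚ] Kb) (Affine.Point.some x y hns) =
      (Affine.Point.some x y hns : (W.baseChange Kb).toAffine.Point)
    rw [Affine.Point.map_some]
    have hτx : τ x = x := by rw [hx]; exact τ.commutes x₀
    have hτy : τ y = y := by
      rw [hy, map_sub, map_mul, map_div₀, map_add, map_mul, hσ, τ.commutes, τ.commutes, τ.commutes, τ.commutes,
        map_ofNat]
    exact point_some_eq_some _ _ hτx hτy
  · -- `σθ = −θ`: `σ` negates the point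
    apply Subtype.ext
    set τ : Kb ≃ₐ[ℚ] Kb := σ with hτ
    change Affine.Point.map (τ : Kb →ₐ[ℚ] Kb) (Affine.Point.some x y hns) =
      -(Affine.Point.some x y hns : (W.baseChange Kb).toAffine.Point)
    rw [Affine.Point.map_some, Affine.Point.neg_some]
    have hτx : τ x = x := by rw [hx]; exact τ.commutes x₀
    have hτy : τ y = (W.baseChange Kb).toAffine.negY x y := by
      rw [hnegY, hy, map_sub, map_mul, map_div₀, map_add, map_mul, hσ, τ.commutes, τ.commutes, τ.commutes,
        τ.commutes, map_ofNat, hx]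
      ring
    exact point_some_eq_some _ _ hτx hτy


/-! ## §3 From the `μ₃`-point to a fixed vector for every `σ` (Weil pairing) -/

/-- **`μ₃ ⊂ W` ⟹ every `σ ∈ Γ_ℚ` fixes a non-zero point of `W[3]`.**  Let `P` be the `μ₃`-point (`σP = ±P` as `σ(√−3) = ±√−3`).
If `σ√−3 = √−3` then `P` itself is fixed.  Otherwise `σP = −P`; with the Weil pairing `e₃` (tree `exists_weilPairing_holds`: bilinear,
alternating, non-degenerate, `Γ_ℚ`-equivariant) pick `Q` with `ζ := e₃(Q, P) ≠ 1`; `(2ζ + 1)² = −3` forces `σζ = ζ²`, and equivariance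
`σζ = e₃(σQ, σP) = e₃(σQ, P)⁻¹` gives `e₃(σQ, P) = ζ = e₃(Q, P)`, so `σQ − Q` lies in the kernel of `e₃(·, P)`, which is the line
`{O, ±P}` (a subgroup of order `3` of the `𝔽₃`-plane `W[3]`, by non-degeneracy and Lagrange); then `Q − (σQ − Q)` is fixed by `σ`
(`σ` acts by `−1` on the line) and is non-zero.  [cite: SilvermanAEC2009, Prop. III.8.1] [cite: SilvermanCSS1997, Ch. II §§7–8] -/
theorem forall_exists_smul_eq_of_hasShortMuThree (W : WeierstrassCurve ℚ) [W.IsElliptic] {c : ℤ} (hc : c ≠ 0)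
    (h : HasShortMuThree W c) :
    ∀ σ : absoluteGaloisGroup ℚ, ∃ P : W.geomTorsion 3, P ≠ 0 ∧ σ • P = P := by
  obtain ⟨θ, P, hθsq, hP0, hgalP⟩ :=
    exists_geomTorsion_of_hasShortMuThree W (hasShortMuThree_one_of_hasShortMuThree W hc h)
  have hsm : ∀ (σ : absoluteGaloisGroup ℚ) (z : AlgebraicClosure ℚ),
      σ • z = (show AlgebraicClosure ℚ ≃ₐ[ℚ] AlgebraicClosure ℚ from σ) z := fun _ _ ↦ rfl
  intro σ
  set τ : AlgebraicClosure ℚ ≃ₐ[ℚ] AlgebraicClosure ℚ := σ with hτ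
  -- `σθ = ±θ`
  have hθpm : τ θ = θ ∨ τ θ = -θ := by
    have h1 : (τ θ) ^ 2 = θ ^ 2 := by rw [← map_pow, hθsq, map_neg, map_ofNat]
    have h2 : (τ θ - θ) * (τ θ + θ) = 0 := by linear_combination h1
    rcases mul_eq_zero.mp h2 with h | h
    · exact Or.inl (sub_eq_zero.mp h)
    · exact Or.inr (eq_neg_of_add_eq_zero_left h)
  rcases hθpm with hσ | hσ
  · exact ⟨P, hP0, (hgalP σ).1 hσ⟩
  have hσP : σ • P = -P := (hgalP σ).2 hσ
  -- basic facts on the line through `P`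
  have h2P : (2 : ℕ) • P = -P := by
    have h3 : (2 : ℕ) • P + P = 0 := by
      rw [← succ_nsmul]
      exact AddSubgroup.torsionBy.nsmul P
    exact eq_neg_of_add_eq_zero_left h3
  have h3P : (3 : ℤ) • P = 0 := by
    change ((3 : ℕ) : ℤ) • P = 0
    rw [natCast_zsmul]
    exact AddSubgroup.torsionBy.nsmul P
  have hline : ∀ S ∈ AddSubgroup.zmultiples P, S = 0 ∨ S = P ∨ S = -P := by
    intro S hS
    obtain ⟨k, rfl⟩ := AddSubgroup.mem_zmultiples_iff.mp hS
    obtain ⟨q, r, hkqr, hr⟩ : ∃ q r : ℤ, k = r + q * 3 ∧ (r = 0 ∨ r = 1 ∨ r = 2) :=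
      ⟨k / 3, k % 3, by omega, by omega⟩
    have hk3 : k • P = r • P := by
      rw [hkqr, add_zsmul, mul_zsmul, h3P, zsmul_zero, add_zero]
    rw [hk3]
    rcases hr with h | h | h
    · left; rw [h, zero_zsmul]
    · right; left; rw [h, one_zsmul]
    · right; right
      rw [h, show (2 : ℤ) = ((2 : ℕ) : ℤ) by norm_num, natCast_zsmul, h2P]
  -- THE WEIL PAIRING `e₃`
  obtain ⟨e, hpow, haddl, haddr, hself, hnondeg, hgal⟩ := W.exists_weilPairing_holds 3 (by norm_num) (by norm_num)
  have hne0 : ∀ S T, e S T ≠ 0 := fun S T h0 ↦ by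
    have := hpow S T
    rw [h0, zero_pow three_ne_zero] at this
    exact zero_ne_one this
  have he0l : ∀ T, e 0 T = 1 := fun T ↦ by
    have h := haddl 0 0 T
    rw [add_zero] at h
    exact (mul_eq_left₀ (hne0 0 T)).mp h.symm
  have henegl : ∀ S T, e (-S) T * e S T = 1 := fun S T ↦ by rw [← haddl, neg_add_cancel, he0l]
  have henegr : ∀ S T, e S (-T) * e S T = 1 := fun S T ↦ by
    have he0r : e S 0 = 1 := by
      have h := haddr S 0 0
      rw [add_zero] at h
      exact (mul_eq_left₀ (hne0 S 0)).mp h.symm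
    rw [← haddr, neg_add_cancel, he0r]
  -- the kernel of `e(·, P)` is the line `{O, ±P}`
  have hcard : Nat.card (W.geomTorsion 3) = 3 ^ 2 := natCard_geomTorsion W 3
  haveI hfin : Finite (W.geomTorsion 3) := Nat.finite_of_card_ne_zero (by rw [hcard]; norm_num)
  let K : AddSubgroup (W.geomTorsion 3) :=
    { carrier := {X | e X P = 1}
      add_mem' := fun {a b} ha hb ↦ by
        simp only [Set.mem_setOf_eq] at ha hb ⊢
        rw [haddl, ha, hb, one_mul]
      zero_mem' := by simp only [Set.mem_setOf_eq]; exact he0l P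
      neg_mem' := fun {a} ha ↦ by
        simp only [Set.mem_setOf_eq] at ha ⊢
        have h := henegl a P
        rwa [ha, mul_one] at h }
  have hmemK : ∀ X, X ∈ K ↔ e X P = 1 := fun X ↦ Iff.rfl
  obtain ⟨Q, hQ⟩ : ∃ Q, e Q P ≠ 1 := by
    by_contra hall
    push Not at hall
    exact hP0 (hnondeg P hall)
  haveI : Fact (Nat.Prime 3) := ⟨Nat.prime_three⟩
  have hordP : addOrderOf P = 3 := addOrderOf_eq_of_ne_zero W 3 hP0
  have hPK : AddSubgroup.zmultiples P ≤ K := AddSubgroup.zmultiples_le.mpr ((hmemK P).mpr (hself P))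
  have hKeq : AddSubgroup.zmultiples P = K := by
    have hdvd : Nat.card K ∣ Nat.card (W.geomTorsion 3) := AddSubgroup.card_addSubgroup_dvd_card K
    rw [hcard] at hdvd
    obtain ⟨k, hk, hk'⟩ := (Nat.dvd_prime_pow Nat.prime_three).mp hdvd
    have hKtop : K ≠ ⊤ := by
      intro htop
      exact hQ ((hmemK Q).mp (htop ▸ AddSubgroup.mem_top Q))
    have hKbot : K ≠ ⊥ := by
      intro hbot
      have hPmem : P ∈ K := hPK (AddSubgroup.mem_zmultiples P)
      rw [hbot, AddSubgroup.mem_bot] at hPmem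
      exact hP0 hPmem
    interval_cases k
    · exact absurd (AddSubgroup.eq_bot_of_card_eq K (by simpa using hk')) hKbot
    · refine AddSubgroup.eq_of_le_of_card_ge hPK ?_
      rw [hk', pow_one, Nat.card_zmultiples, hordP]
    · exact absurd ((AddSubgroup.card_eq_iff_eq_top K).mp (hk'.trans hcard.symm)) hKtop
  have hker : ∀ X, e X P = 1 → X = 0 ∨ X = P ∨ X = -P := fun X hX ↦
    hline X (hKeq ▸ (hmemK X).mpr hX)
  -- `ζ := e Q P`, a primitive cube root of unity; `σζ = ζ²` because `σθ = −θ` and `(2ζ + 1)² = −3 = θ²`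
  set ζ := e Q P with hζ
  have hζ3 : ζ ^ 3 = 1 := hpow Q P
  have hζ2 : ζ ^ 2 = -ζ - 1 := by
    have h : (ζ - 1) * (ζ ^ 2 + ζ + 1) = 0 := by ring_nf; linear_combination hζ3
    rcases mul_eq_zero.mp h with h | h
    · exact absurd (sub_eq_zero.mp h) hQ
    · linear_combination h
  have h2ζ : 2 * ζ + 1 = θ ∨ 2 * ζ + 1 = -θ := by
    have h1 : (2 * ζ + 1) ^ 2 = θ ^ 2 := by rw [hθsq]; linear_combination (4 : AlgebraicClosure ℚ) * hζ2
    have h2 : (2 * ζ + 1 - θ) * (2 * ζ + 1 + θ) = 0 := by linear_combination h1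
    rcases mul_eq_zero.mp h2 with h | h
    · exact Or.inl (sub_eq_zero.mp h)
    · exact Or.inr (eq_neg_of_add_eq_zero_left h)
  have h2τ : τ (2 : AlgebraicClosure ℚ) = 2 := map_ofNat τ 2
  have hσζ : τ ζ = ζ ^ 2 := by
    -- `τ (2ζ + 1) = −(2ζ + 1)` in either sign case
    have hneg : τ (2 * ζ + 1) = -(2 * ζ + 1) := by
      rcases h2ζ with h | h
      · rw [h, hσ]
      · rw [h, map_neg, hσ, neg_neg]
    rw [map_add, map_mul, map_one, h2τ] at hneg
    rw [hζ2]
    linear_combination (1 / 2 : AlgebraicClosure ℚ) * hneg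
  -- equivariance: `σζ = e(σQ, σP) = e(σQ, −P)`, so `e(σQ, P) = ζ`
  have hσQP : e (σ • Q) P = ζ := by
    have hg : σ • ζ = e (σ • Q) (σ • P) := hgal σ Q P
    rw [hsm, hσP] at hg
    change τ ζ = e (σ • Q) (-P) at hg
    have h1 : e (σ • Q) (-P) * e (σ • Q) P = 1 := henegr (σ • Q) P
    rw [← hg, hσζ] at h1
    -- `ζ² · e(σQ, P) = 1` and `ζ² · ζ = 1`
    have h2 : ζ ^ 2 * ζ = 1 := by rw [← pow_succ]; exact hζ3
    have hζ0 : ζ ^ 2 ≠ 0 := pow_ne_zero 2 (hne0 Q P)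
    exact mul_left_cancel₀ hζ0 (h1.trans h2.symm)
  -- `S := σQ − Q` is in the kernel of `e(·, P)`, hence on the line
  have hS : e (σ • Q - Q) P = 1 := by
    have h1 : e (σ • Q - Q) P * e Q P = e (σ • Q) P := by rw [← haddl, sub_add_cancel]
    rw [hσQP] at h1
    exact (mul_eq_right₀ (hne0 Q P)).mp h1
  have hSline := hker _ hS
  -- `σ` acts by `−1` on the line, so `R := Q − S` is fixed
  have hσS : σ • (σ • Q - Q) = -(σ • Q - Q) := by
    rcases hSline with h0 | h0 | h0 <;> rw [h0]
    · rw [smul_zero, neg_zero]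
    · exact hσP
    · rw [smul_neg, hσP]
  refine ⟨Q - (σ • Q - Q), ?_, ?_⟩
  · intro hR
    have hQS : Q = σ • Q - Q := sub_eq_zero.mp hR
    have h' := hS
    rw [← hQS] at h'
    exact hQ h'
  · rw [smul_sub, hσS]
    have h3S : (3 : ℤ) • (σ • Q - Q) = 0 := by
      rcases hSline with h0 | h0 | h0 <;> rw [h0]
      · rw [zsmul_zero]
      · exact h3P
      · rw [zsmul_neg, h3P, neg_zero]
    -- `σQ − (−S) − (Q − S) = 3S = 0` with `S = σQ − Q`
    have key : σ • Q - -(σ • Q - Q) - (Q - (σ • Q - Q)) = (3 : ℤ) • (σ • Q - Q) := by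
      rw [show (3 : ℤ) = 1 + 1 + 1 by norm_num, add_zsmul, add_zsmul, one_zsmul]
      abel
    exact sub_eq_zero.mp (key.trans h3S)

/-! ## §4 E-an-226 `MuThreeSignAtThree` BY NAME, unconditionally -/

/-- **E-an-226 `MuThreeSignAtThree` HOLDS, unconditionally** (an g40's «paper-provable local sign lemma», the `μ₃` twin of E-an-226♮): `3 ∥ N`
and `μ₃ ⊂ W` (`HasShortMuThree W c`) ⟹ `λ₃(f) = −1`.  The reduction at `3` is multiplicative (`3 ∥ N`); every `σ ∈ Γ_ℚ` fixes a non-zero point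
of `W[3]` (§3), so Katz's theorem and Tate uniformisation make it SPLIT (`hasSplitMultiplicativeReductionAtPrime_three_of_forall_exists_smul_eq`);
`a₃ = +1`, `λ₃ = −a₃ = −1`.  With this file and p744182 BOTH inputs of an's `shimuraIndexPrimeToThreeAtMultiplicativeThree_of_signLemmas` are
theorems. [cite: AtkinLehner1970, Thm. 3] [cite: Katz1980, Thm. 2] [cite: SilvermanAEC2009, Thm. VII.6.1 and Prop. III.8.1] -/
theorem muThreeSignAtThree_holds : MuThreeSignAtThree := by
  intro W _ _ N _ D h3 h9 hμ
  haveI : Fact (Nat.Prime 3) := ⟨Nat.prime_three⟩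
  have hmult := hasMultiplicativeReductionAtPrime_three_of_three_exactly_dvd_level W D.isNewformOf h3 h9
  exact atkinLehnerEigenvalueAt_three_eq_neg_one_of_split W D.isNewformOf h3 h9
    (hasSplitMultiplicativeReductionAtPrime_three_of_forall_exists_smul_eq W
      (forall_exists_smul_eq_of_hasShortMuThree W D.maninConstant_ne_zero_holds hμ) hmult)

end Summit.BirchSwinnertonDyer.BirchSwinnertonDyer.Theorems.ManinLocalTwoThree.ShimuraIndexAtThree

end
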